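import Literature.NumberTheory.Automorphic.LevelActionCoefficientChange
import Literature.NumberTheory.Automorphic.SymPowOrdinaryLine
import HarnessLib

/-!
# Independence of weight for `GL₂` at one place: the `Sym^m` coefficients modulo `ϖ^r`

Topic `NumberTheory/Automorphic`; namespace `Literature.NumberTheory.Automorphic.IntegralWeightGL2`.
The `GL₂`, one-place instance of the generic change-of-coefficients machinery of
`LevelActionCoefficientChange` (push-forward `φ_*`, weight-raising operator `Θ`), with the
coefficient algebra of `SymPowOrdinaryLine`, for the proof of Hida's control theorem
(`hidaControl_dominantOrdinaryPoint`): **independence of weight**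
[KhareThorne2017, §6.4, Prop. 6.13]; [Hida1994AIF, §2, Prop. 2.1].

Fix a number field `K`, a finite place `v`, a commutative ring `S` and a ring homomorphism
`red : 𝒪_v → S` (intended: `S = 𝒪_v/ϖ^r`, or `𝒪_E/ϖ^r` through an embedding).

* `iwahoriMonoid K v red` — the **Iwahori Hecke monoid modulo `ker red`**: finite-adelic `g` with
  `g_v ∈ M₂(𝒪_v)` and `red((g_v)₁₀) = 0` (it contains the Iwahori levels `U(c,c)`, `c ≥ r`, the
  Hecke elements `t_{v,1}^r` (`heckeElement_pow_mem_iwahoriMonoid`), the diamonds, and everything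
  integral and trivial at `v`); `redMatrix : iwahoriMonoid → M₂(S)` its reduced local component.
* `symPowCoeff red m` — the action `τ` of the monoid on `Sym^m(S²) = SymPow S m` through `redMatrix`
  (the tree's `symPowAction`, column convention `X_i ↦ ∑_j A_{ji} X_j`);
  `lowChar red m` — the character `χ_m(g) = red((g_v)₁₁)^m` as scalar action on `S` (the coefficients
  "`S(χ_m)`": trivial coefficients with the diamond twist of slot `1`);
  `coeffX₁ m : Sym^m → S` — `λ₁ = ` coefficient of `X₁^m`; `smulX₁pow m : S → Sym^m`, `c ↦ c X₁^m`.
* The three hypotheses of `LevelActionCoefficientChange`: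
  `coeffX₁_comp_symPowCoeff` (**`λ₁` is equivariant `Sym^m → S(χ_m)`**),
  `coeffX₁_comp_smulX₁pow` (`λ₁(c X₁^m) = c`), and
  `heckeFactorsThrough_of_redMatrix_col_zero` (**every `y ∈ U α U` factors through `λ₁` as soon as
  the first column of `red(α_v)` vanishes** — e.g. `α = t_{v,1}^r` when `red(ϖ_v)^r = 0`,
  `redMatrix_heckeElement_pow_col_zero`).
* `independenceOfWeight_bijOn` — the resulting abstract independence of weight: `(λ₁)_*` is a
  bijection between parts `X₀ ⊆ H^i(U, Sym^m(S))`, `Y₀ ⊆ H^i(U, S(χ_m))` exchanged with `Θ` on which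
  `U_v^r = [U t_{v,1}^r U]` is injective, resp. surjective (the ordinary parts of finite cohomology
  groups). [KhareThorne2017, Prop. 6.13]

## References

* C. Khare, J. A. Thorne, *Potential automorphy and the Leopoldt conjecture*, Amer. J. Math. 139
  (2017), §6.4, Prop. 6.13 (arXiv:1409.7007, held; read 2026-08-16). [KhareThorne2017]
* H. Hida, *p-adic ordinary Hecke algebras for GL(2)*, Ann. Inst. Fourier 44 (1994), §2, Prop. 2.1
  (held). [Hida1994AIF]
-/

noncomputable section

open MvPolynomial IsDedekindDomain NumberField Literature.Computability.AlgebraicComplexity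

universe u

namespace Literature.NumberTheory.Automorphic.IntegralWeightGL2

open BigHeckeGLn LevelAction

variable (K : Type) [Field K] [NumberField K] (v : HeightOneSpectrum (𝓞 K)) {S : Type} [CommRing S]
  (red : v.adicCompletionIntegers K →+* S)

/-! ### The Iwahori Hecke monoid modulo `ker red` -/

/-- **The Iwahori Hecke monoid at `v` modulo `ker red`**: finite-adelic matrices `g` whose
component `g_v` is integral with `red((g_v)₁₀) = 0` (upper triangular modulo `ker red`).
[cite: KhareThorne2017, §6.4] [cite: Hida1994AIF, §1 (1.7)] -/
def iwahoriMonoid : Submonoid (FiniteAdelicGL 2 K) where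
  carrier := {g | localComponent 2 K v g ∈ integralAt K 2 v ∧
    ∃ x : v.adicCompletionIntegers K, red x = 0 ∧ (x : v.adicCompletion K) =
      ((localComponent 2 K v g : GL (Fin 2) (v.adicCompletion K)) :
        Matrix (Fin 2) (Fin 2) (v.adicCompletion K)) 1 0}
  one_mem' := by
    refine ⟨by rw [map_one]; exact one_mem _, 0, map_zero red, ?_⟩
    rw [map_one, Units.val_one, Matrix.one_apply_ne (by decide)]
    rfl
  mul_mem' := by
    rintro a b ⟨ha, x, hx, hxa⟩ ⟨hb, y, hy, hyb⟩
    refine ⟨by rw [map_mul]; exact mul_mem ha hb, x * ⟨_, hb 0 0⟩ + ⟨_, ha 1 1⟩ * y, ?_, ?_⟩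
    · rw [map_add, map_mul, map_mul, hx, hy, zero_mul, mul_zero, add_zero]
    · rw [map_mul, Units.val_mul, Matrix.mul_apply, Fin.sum_univ_two]
      push_cast
      rw [hxa, hyb]

variable {K v red} in
/-- Membership in the Iwahori monoid (definitional). [folklore] -/
theorem mem_iwahoriMonoid_iff {g : FiniteAdelicGL 2 K} :
    g ∈ iwahoriMonoid K v red ↔ localComponent 2 K v g ∈ integralAt K 2 v ∧
      ∃ x : v.adicCompletionIntegers K, red x = 0 ∧ (x : v.adicCompletion K) =
        ((localComponent 2 K v g : GL (Fin 2) (v.adicCompletion K)) :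
          Matrix (Fin 2) (Fin 2) (v.adicCompletion K)) 1 0 :=
  Iff.rfl

/-- The integral local component at `v` of an element of the Iwahori monoid. [folklore] -/
def localInt : iwahoriMonoid K v red →* integralAt K 2 v where
  toFun g := ⟨localComponent 2 K v g, g.2.1⟩
  map_one' := Subtype.ext (by simp)
  map_mul' a b := Subtype.ext (by simp)

/-- **The reduced local component `red(g_v) ∈ M₂(S)`**, multiplicatively. [folklore] -/
def redMatrix : iwahoriMonoid K v red →* Matrix (Fin 2) (Fin 2) S :=
  red.mapMatrix.toMonoidHom.comp ((toIntMatrix K 2 v).comp (localInt K v red))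

variable {K v red} in
/-- Entries of `redMatrix`. [folklore] -/
theorem redMatrix_apply (g : iwahoriMonoid K v red) (i j : Fin 2) :
    redMatrix K v red g i j = red (toIntMatrix K 2 v (localInt K v red g) i j) :=
  rfl

variable {K v red} in
/-- The entries of the integral local component are those of `g_v`. [folklore] -/
theorem coe_toIntMatrix_localInt_apply (g : iwahoriMonoid K v red) (i j : Fin 2) :
    ((toIntMatrix K 2 v (localInt K v red g) i j : v.adicCompletionIntegers K) : v.adicCompletion K) =
      ((localComponent 2 K v g : GL (Fin 2) (v.adicCompletion K)) :
        Matrix (Fin 2) (Fin 2) (v.adicCompletion K)) i j :=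
  rfl

variable {K v red} in
/-- **`red(g_v)` is upper triangular**: `(redMatrix g)₁₀ = 0`. [folklore] -/
theorem redMatrix_one_zero (g : iwahoriMonoid K v red) : redMatrix K v red g 1 0 = 0 := by
  obtain ⟨x, hx, hxg⟩ := g.2.2
  have : toIntMatrix K 2 v (localInt K v red g) 1 0 = x :=
    Subtype.ext (by rw [coe_toIntMatrix_localInt_apply, hxg])
  rw [redMatrix_apply, this, hx]

/-! ### The coefficient modules `Sym^m(S)` and `S(χ_m)` -/

/-- **The action `τ` of the Iwahori monoid on `Sym^m(S²)`** through `red(g_v)` (`symPowAction`).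
[cite: KhareThorne2017, §6.4] [cite: Hida1994AIF, §1] -/
def symPowCoeff (m : ℕ) : iwahoriMonoid K v red →* Module.End S (SymPow S m) :=
  (symPowAction S m).comp (redMatrix K v red)

variable {K v red} in
/-- Unfolding lemma for `symPowCoeff`. [folklore] -/
theorem symPowCoeff_apply (m : ℕ) (g : iwahoriMonoid K v red) (P : SymPow S m) :
    symPowCoeff K v red m g P = symPowAction S m (redMatrix K v red g) P :=
  rfl

/-- The character `χ_m(g) = red((g_v)₁₁)^m` of the Iwahori monoid (multiplicative because
`red(g_v)` is upper triangular). [cite: KhareThorne2017, §6.4] -/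
def lowCharFun (m : ℕ) : iwahoriMonoid K v red →* S where
  toFun g := redMatrix K v red g 1 1 ^ m
  map_one' := by rw [map_one, Matrix.one_apply_eq, one_pow]
  map_mul' a b := by
    rw [map_mul, Matrix.mul_apply, Fin.sum_univ_two, redMatrix_one_zero, zero_mul, zero_add, mul_pow]

/-- **The coefficients `S(χ_m)`**: `S` with the Iwahori monoid acting through the character
`χ_m(g) = red((g_v)₁₁)^m` (trivial coefficients with the slot-`1` diamond twist).
[cite: KhareThorne2017, §6.4] -/
def lowChar (m : ℕ) : iwahoriMonoid K v red →* Module.End S S :=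
  (algebraMap S (Module.End S S) : S →+* Module.End S S).toMonoidHom.comp (lowCharFun K v red m)

variable {K v red} in
/-- Unfolding lemma: `χ_m(g) c = red((g_v)₁₁)^m c`. [folklore] -/
@[simp]
theorem lowChar_apply (m : ℕ) (g : iwahoriMonoid K v red) (c : S) :
    lowChar K v red m g c = redMatrix K v red g 1 1 ^ m * c := by
  change (algebraMap S (Module.End S S) (redMatrix K v red g 1 1 ^ m)) c = _
  rw [Module.algebraMap_end_apply, smul_eq_mul]

/-- **`λ₁ : Sym^m(S²) → S`, the coefficient of `X₁^m`** (the `U_v`-ordinary functional).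
[cite: KhareThorne2017, §6.4 (β_𝛌)] -/
def coeffX₁ (S : Type) [CommRing S] (m : ℕ) : SymPow S m →ₗ[S] S :=
  (lcoeff S (Finsupp.single 1 m)).comp (Submodule.subtype _)

/-- Unfolding lemma for `coeffX₁`. [folklore] -/
@[simp]
theorem coeffX₁_apply (S : Type) [CommRing S] (m : ℕ) (P : SymPow S m) :
    coeffX₁ S m P = coeff (Finsupp.single 1 m) (P : MvPolynomial (Fin 2) S) :=
  rfl

/-- The element `X₁^m ∈ Sym^m(S²)`. [folklore] -/
def X₁pow (S : Type) [CommRing S] (m : ℕ) : SymPow S m :=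
  ⟨X 1 ^ m, (mem_homogeneousSubmodule _ _).2 (isHomogeneous_X_pow _ _)⟩

/-- Unfolding lemma for `X₁pow`. [folklore] -/
@[simp]
theorem coe_X₁pow (S : Type) [CommRing S] (m : ℕ) :
    (X₁pow S m : MvPolynomial (Fin 2) S) = X 1 ^ m :=
  rfl

/-- **`ψ : S → Sym^m(S²)`, `c ↦ c X₁^m`** (the section of `λ₁` along the ordinary line).
[cite: KhareThorne2017, §6.4 (α_𝛌)] -/
def smulX₁pow (S : Type) [CommRing S] (m : ℕ) : S →ₗ[S] SymPow S m :=
  LinearMap.toSpanSingleton S (SymPow S m) (X₁pow S m)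

/-- Unfolding lemma for `smulX₁pow`. [folklore] -/
@[simp]
theorem smulX₁pow_apply (S : Type) [CommRing S] (m : ℕ) (c : S) :
    smulX₁pow S m c = c • X₁pow S m :=
  rfl

/-! ### The three hypotheses of the change-of-coefficients machinery -/

variable {K v red}

/-- **`λ₁` is equivariant `Sym^m(S²) → S(χ_m)`**: `λ₁(g · P) = red((g_v)₁₁)^m λ₁(P)` (the reduced
local components are upper triangular). [cite: KhareThorne2017, §6.4, proof of Prop. 6.13] -/
theorem coeffX₁_comp_symPowCoeff (m : ℕ) (g : iwahoriMonoid K v red) :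
    coeffX₁ S m ∘ₗ symPowCoeff K v red m g = lowChar K v red m g ∘ₗ coeffX₁ S m := by
  refine LinearMap.ext fun P => ?_
  rw [LinearMap.comp_apply, LinearMap.comp_apply, coeffX₁_apply, coeffX₁_apply, symPowCoeff_apply,
    lowChar_apply]
  exact coeff_symPowAction_of_lowerLeft_eq_zero (redMatrix_one_zero g) P

/-- `λ₁(c X₁^m) = c`. [folklore] -/
theorem coeffX₁_comp_smulX₁pow (S : Type) [CommRing S] (m : ℕ) :
    coeffX₁ S m ∘ₗ smulX₁pow S m = LinearMap.id := by
  refine LinearMap.ext fun c => ?_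
  rw [LinearMap.comp_apply, smulX₁pow_apply, map_smul, coeffX₁_apply, coe_X₁pow, X_pow_eq_monomial,
    coeff_monomial, if_pos rfl, smul_eq_mul, mul_one, LinearMap.id_apply]

/-- **An element whose reduced local component has vanishing first column factors through `λ₁`**:
`g · P = λ₁(P) (g · X₁^m)`, i.e. `τ(g) ∘ ψ ∘ λ₁ = τ(g)`. [cite: KhareThorne2017, §6.4, proof of Prop. 6.13] -/
theorem symPowCoeff_comp_smulX₁pow_comp_coeffX₁ (m : ℕ) {g : iwahoriMonoid K v red}
    (h00 : redMatrix K v red g 0 0 = 0) :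
    symPowCoeff K v red m g ∘ₗ (smulX₁pow S m ∘ₗ coeffX₁ S m) = symPowCoeff K v red m g := by
  refine LinearMap.ext fun P => Subtype.ext ?_
  rw [LinearMap.comp_apply, LinearMap.comp_apply, smulX₁pow_apply, map_smul, symPowCoeff_apply,
    symPowCoeff_apply, Submodule.coe_smul, coe_symPowAction_apply, coe_X₁pow, coeffX₁_apply,
    coe_symPowAction_eq_coeff_smul_of_col_zero h00 (redMatrix_one_zero g)]

/-- In a product `M A N` of `2 × 2` matrices with `A`'s first column zero and `N₁₀ = 0`, the first
column vanishes. [folklore] -/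
theorem mul_mul_apply_zero_eq_zero {M A N : Matrix (Fin 2) (Fin 2) S} (hA : ∀ i, A i 0 = 0)
    (hN : N 1 0 = 0) (i : Fin 2) : (M * A * N) i 0 = 0 := by
  rw [Matrix.mul_apply, Fin.sum_univ_two, hN, mul_zero, add_zero, Matrix.mul_apply, Fin.sum_univ_two,
    hA 0, hA 1, mul_zero, mul_zero, add_zero, zero_mul]

/-- **Along a double coset `U α U` (`U ⊆` the Iwahori monoid) the first column of the reduced local
component vanishes as soon as it does for `α`.** [cite: KhareThorne2017, §6.4, proof of Prop. 6.13] -/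
theorem redMatrix_apply_zero_eq_zero_of_mem_doubleCosetQuot {U : Subgroup (FiniteAdelicGL 2 K)}
    (hU : U.toSubmonoid ≤ iwahoriMonoid K v red) {α : FiniteAdelicGL 2 K}
    (hα : α ∈ iwahoriMonoid K v red) (hα0 : ∀ i, redMatrix K v red ⟨α, hα⟩ i 0 = 0)
    {y : FiniteAdelicGL 2 K} (hy : y ∈ iwahoriMonoid K v red)
    (hyd : (y : FiniteAdelicGL 2 K ⧸ U) ∈ ArithmeticQuotient.doubleCosetQuot U α) (i : Fin 2) :
    redMatrix K v red ⟨y, hy⟩ i 0 = 0 := by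
  obtain ⟨u, hu, huy⟩ := exists_mk_eq_of_mem_doubleCosetQuot hyd
  have hu' : (u * α)⁻¹ * y ∈ U := QuotientGroup.eq.1 huy
  have hy_eq : (⟨y, hy⟩ : iwahoriMonoid K v red) =
      ⟨u, hU hu⟩ * ⟨α, hα⟩ * ⟨(u * α)⁻¹ * y, hU hu'⟩ :=
    Subtype.ext (by simp [mul_assoc])
  rw [hy_eq, map_mul, map_mul]
  exact mul_mul_apply_zero_eq_zero hα0 (redMatrix_one_zero _) i

/-- **The factorisation hypothesis `HeckeFactorsThrough` for `(Sym^m(S²), λ₁, ψ)` along `U α U`**,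
whenever the first column of `red(α_v)` vanishes. [cite: KhareThorne2017, §6.4, proof of Prop. 6.13] -/
theorem heckeFactorsThrough_of_redMatrix_col_zero (m : ℕ) {U : Subgroup (FiniteAdelicGL 2 K)}
    (hU : U.toSubmonoid ≤ iwahoriMonoid K v red) {α : FiniteAdelicGL 2 K}
    (hα : α ∈ iwahoriMonoid K v red) (hα0 : ∀ i, redMatrix K v red ⟨α, hα⟩ i 0 = 0) :
    HeckeFactorsThrough (iwahoriMonoid K v red) (symPowCoeff K v red m) U (coeffX₁ S m)
      (smulX₁pow S m) α := fun _ hy hyd =>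
  symPowCoeff_comp_smulX₁pow_comp_coeffX₁ m
    (redMatrix_apply_zero_eq_zero_of_mem_doubleCosetQuot hU hα hα0 hy hyd 0)

/-! ### The Hecke element `t_{v,1}^r` -/

variable (K v red)

/-- The local component of `t_{v,1}^r` is `diag(ϖ_v^r, 1)`. [folklore] -/
theorem localComponent_heckeElement_one_pow (r : ℕ) :
    localComponent 2 K v (heckeElement 2 K v 1 ^ r) =
      glDiagonal 2 (v.adicCompletion K) fun l => if l.val < 1 then uniformizerAt v ^ r else 1 := by
  rw [map_pow, heckeElement_eq_ofLocal, localComponent_ofLocal, ← map_pow]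
  congr 1
  funext l
  simp only [Pi.pow_apply]
  split_ifs
  · rfl
  · exact one_pow r

/-- Entries of the local component of `t_{v,1}^r`. [folklore] -/
theorem coe_localComponent_heckeElement_one_pow_apply (r : ℕ) (i j : Fin 2) :
    ((localComponent 2 K v (heckeElement 2 K v 1 ^ r) : GL (Fin 2) (v.adicCompletion K)) :
        Matrix (Fin 2) (Fin 2) (v.adicCompletion K)) i j =
      if i = j then (if i = 0 then ((uniformizerAt v : (v.adicCompletion K)ˣ) : v.adicCompletion K) ^ r
        else 1) else 0 := by
  rw [localComponent_heckeElement_one_pow, coe_glDiagonal, Matrix.diagonal_apply]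
  have hcond : i.val < 1 ↔ i = 0 := by
    constructor
    · intro h
      exact Fin.ext (by simpa using h)
    · rintro rfl
      simp
  by_cases hij : i = j
  · rw [if_pos hij, if_pos hij]
    by_cases hi : i = 0
    · rw [if_pos hi, if_pos (hcond.2 hi), Units.val_pow_eq_pow_val]
    · rw [if_neg hi, if_neg (mt hcond.1 hi), Units.val_one]
  · rw [if_neg hij, if_neg hij]

/-- **`t_{v,1}^r` lies in the Iwahori monoid** (its local component `diag(ϖ^r, 1)` is integral and
diagonal). [folklore] -/
theorem heckeElement_pow_mem_iwahoriMonoid (r : ℕ) :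
    heckeElement 2 K v 1 ^ r ∈ iwahoriMonoid K v red := by
  refine ⟨fun i j => ?_, 0, map_zero red, ?_⟩
  · rw [coe_localComponent_heckeElement_one_pow_apply]
    split_ifs
    · exact pow_mem (uniformizerAt_mem_adicCompletionIntegers K v) r
    · exact one_mem _
    · exact zero_mem _
  · rw [coe_localComponent_heckeElement_one_pow_apply, if_neg (by decide)]
    rfl

/-- **The first column of `red(t_{v,1}^r) = diag(red(ϖ_v)^r, 1)` vanishes when `red(ϖ_v)^r = 0`**
(e.g. `S = 𝒪/ϖ^r`). [folklore] -/
theorem redMatrix_heckeElement_pow_col_zero (r : ℕ)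
    (hr : red ⟨_, uniformizerAt_mem_adicCompletionIntegers K v⟩ ^ r = 0) (i : Fin 2) :
    redMatrix K v red ⟨heckeElement 2 K v 1 ^ r, heckeElement_pow_mem_iwahoriMonoid K v red r⟩ i 0 = 0 := by
  rw [redMatrix_apply]
  fin_cases i
  · have : toIntMatrix K 2 v (localInt K v red
        ⟨heckeElement 2 K v 1 ^ r, heckeElement_pow_mem_iwahoriMonoid K v red r⟩) 0 0 =
        ⟨_, uniformizerAt_mem_adicCompletionIntegers K v⟩ ^ r :=
      Subtype.ext (by
        rw [coe_toIntMatrix_localInt_apply, SubmonoidClass.coe_pow]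
        exact (coe_localComponent_heckeElement_one_pow_apply K v r 0 0).trans (by simp))
    simp only [Fin.zero_eta, Fin.isValue]
    rw [this, map_pow, hr]
  · have : toIntMatrix K 2 v (localInt K v red
        ⟨heckeElement 2 K v 1 ^ r, heckeElement_pow_mem_iwahoriMonoid K v red r⟩) 1 0 = 0 :=
      Subtype.ext (by
        rw [coe_toIntMatrix_localInt_apply]
        exact (coe_localComponent_heckeElement_one_pow_apply K v r 1 0).trans (by simp))
    simp only [Fin.mk_one, Fin.isValue]
    rw [this, map_zero]

/-! ### Independence of weight (abstract form) for `U_v^r = [U t_{v,1}^r U]` -/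

/-- **Independence of weight for `GL₂` at `v`, abstract form.**  For a level `U` inside the Iwahori
monoid modulo `ker red` and `r` with `red(ϖ_v)^r = 0`: on parts `X₀ ⊆ H^i(U, Sym^m(S²))`,
`Y₀ ⊆ H^i(U, S(χ_m))` exchanged by `(λ₁)_*` and the weight-raising operator `Θ` and on which
`U_v^r = [U t_{v,1}^r U]` is injective, resp. surjective (the `U_v`-ordinary parts of finite
cohomology groups), `(λ₁)_* : X₀ → Y₀` is a bijection. [cite: KhareThorne2017, §6.4, Prop. 6.13]
[cite: Hida1994AIF, §2, Prop. 2.1] -/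
theorem independenceOfWeight_bijOn {Γ : Type} [Group Γ] (ι : Γ →* FiniteAdelicGL 2 K) (m : ℕ)
    {U : Subgroup (FiniteAdelicGL 2 K)} (hU : U.toSubmonoid ≤ iwahoriMonoid K v red) (r : ℕ)
    (hr : red ⟨_, uniformizerAt_mem_adicCompletionIntegers K v⟩ ^ r = 0) (i : ℕ)
    {X₀ : Set (cohomology ι (iwahoriMonoid K v red) (symPowCoeff K v red m) U i)}
    {Y₀ : Set (cohomology ι (iwahoriMonoid K v red) (lowChar K v red m) U i)}
    (hB : Set.MapsTo (pushforwardCohomology ι (iwahoriMonoid K v red) (symPowCoeff K v red m)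
      (lowChar K v red m) U (coeffX₁ S m) (coeffX₁_comp_symPowCoeff m) i).hom X₀ Y₀)
    (hA : Set.MapsTo (raiseCohomology ι (iwahoriMonoid K v red) (symPowCoeff K v red m)
      (lowChar K v red m) U (smulX₁pow S m) (heckeElement 2 K v 1 ^ r) (coeffX₁ S m)
      (coeffX₁_comp_symPowCoeff m) (coeffX₁_comp_smulX₁pow S m) hU
      (heckeElement_pow_mem_iwahoriMonoid K v red r)
      (heckeFactorsThrough_of_redMatrix_col_zero m hU (heckeElement_pow_mem_iwahoriMonoid K v red r)
        (redMatrix_heckeElement_pow_col_zero K v red r hr)) i).hom Y₀ X₀)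
    (hinj : Set.InjOn (heckeCohomology ι (iwahoriMonoid K v red) (symPowCoeff K v red m) U hU
      (heckeElement_pow_mem_iwahoriMonoid K v red r) i) X₀)
    (hsurj : Set.SurjOn (heckeCohomology ι (iwahoriMonoid K v red) (lowChar K v red m) U hU
      (heckeElement_pow_mem_iwahoriMonoid K v red r) i) Y₀ Y₀) :
    Set.BijOn (pushforwardCohomology ι (iwahoriMonoid K v red) (symPowCoeff K v red m)
      (lowChar K v red m) U (coeffX₁ S m) (coeffX₁_comp_symPowCoeff m) i).hom X₀ Y₀ :=
  bijOn_pushforwardCohomology ι _ _ _ U _ _ _ _ _ hU _ _ i hB hA hinj hsurj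

end Literature.NumberTheory.Automorphic.IntegralWeightGL2
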